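import Summits.AtomisticToContinuum.HydrodynamicLimit.Theses.JParityClosure
import Summits.AtomisticToContinuum.HydrodynamicLimit.Theses.InformationPercolationEngine
import Summits.AtomisticToContinuum.HydrodynamicLimit.Theses.TwoClocks
import Summits.AtomisticToContinuum.HydrodynamicLimit.Theses.LimitCollisionMeasure
import Summits.AtomisticToContinuum.HydrodynamicLimit.Theorems.InformationPercolationEngineChaosClosesEulerEnskogIdentity
import Summits.AtomisticToContinuum.HydrodynamicLimit.Theorems.InformationPercolationEngineChaosClosesEulerCollisionMomentUI
import Summits.AtomisticToContinuum.HydrodynamicLimit.Theorems.InformationPercolationEngineChaosClosesEulerReadout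
import Summits.AtomisticToContinuum.HydrodynamicLimit.Theorems.InformationPercolationEngineChaosClosesEulerMassBalanceC1
import Summits.AtomisticToContinuum.HydrodynamicLimit.Theorems.InformationPercolationEngineChaosClosesEulerWeakEquation
import Summits.AtomisticToContinuum.HydrodynamicLimit.Theorems.InformationPercolationEngineChaosClosesEulerInitialLayer
import Summits.AtomisticToContinuum.HydrodynamicLimit.Theorems.InformationPercolationEngineChaosClosesEulerBF18Shell
import Summits.AtomisticToContinuum.HydrodynamicLimit.Theorems.InformationPercolationEngineChaosClosesEulerKineticReduction
import Summits.AtomisticToContinuum.HydrodynamicLimit.Theorems.JParityClosureParityBandClosurePressureValueOfEvenStress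
import Summits.AtomisticToContinuum.HydrodynamicLimit.Theorems.JParityClosureParityBandClosureInverseCollisionInvariance
import Summits.AtomisticToContinuum.HydrodynamicLimit.Theorems.JParityClosureParityBandClosureDetailedBalanceOfSymmetricRecord
import Summits.AtomisticToContinuum.HydrodynamicLimit.Theorems.JParityClosureParityBandClosureProductionZeroOfDetailedBalance
import Summits.AtomisticToContinuum.HydrodynamicLimit.Theorems.JParityClosureParityBandClosureIsotropyOfVanishingProduction
import Summits.AtomisticToContinuum.HydrodynamicLimit.Theorems.JParityClosureParityBandClosureIsotropyOfDiracOrMaxwellian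
import Summits.AtomisticToContinuum.HydrodynamicLimit.Theorems.ParityBandClosure.Negative.YoungMixingObstruction
import Summits.AtomisticToContinuum.HydrodynamicLimit.Theorems.JParityClosureParityBandClosureExactParityRigidity
import Summits.AtomisticToContinuum.HydrodynamicLimit.Theorems.JParityClosureParityBandClosureSurprisalTestContinuity
import Summits.AtomisticToContinuum.HydrodynamicLimit.Theorems.JParityClosureParityBandClosureMomentSemicontinuity
import Summits.AtomisticToContinuum.HydrodynamicLimit.Theorems.JParityClosureParityBandClosureCountableTestUpgrade
import Summits.AtomisticToContinuum.HydrodynamicLimit.Theorems.JParityClosureParityBandClosureParityStabilityOfRigidity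
import Mathlib.MeasureTheory.Measure.ProbabilityMeasure
import Mathlib.MeasureTheory.Measure.FiniteMeasure
import HarnessLib

/-!
# Line `transfer-weighted-parity-chain` — crux `JParityClosure.ParityBandClosure` (stmt-AtomisticToContinuum-17608), skeleton v4 (lead c2)

v4 (lead c2, 2026-08-17, after wave 1) = v3 with `ParityStability` CLOSED (five pieces landed: p164294, p165357+p165132,
p164742, p165416+p165090, p165739+p165240; standalone p166406) and `stub_kineticHalf` SPLIT at its natural seam into
`stub_windowCovarianceIsotropy` + `stub_stressIsotropyOfWindowCovariance` through the waypoint `WindowCovarianceIsotropy` (§1d).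

v3 (lead c2, 2026-08-17) = the planner's v2 with TWO reshapes, composition idea unchanged:

(A) THE PW INPUTS GET TIME WINDOWS OF WIDTH `r²` (was `r`).  Lead's audit of v2's `stub_kineticHalf` plan ("window
second moments vs same-time cone stresses differ by conserved, time-equicontinuous fields only"): the `r`-mollified
conserved fields are time-Lipschitz only with constant `≍ e_flat/r` (transport against `∇b_x`, `‖∇b_x‖/‖b_x‖ ≍ 1/r`;
transfer against `b_x(x_i) − b_x(x_j)`), so over a time window of width `r` the within-window bulk-velocity
fluctuation `D_w := ∫b_t m⊗m/ρ ds − m̄⊗m̄/ρ_w ⪰ 0` in the exact identity `a:∫b_t P_r ds = a:(ρ_w C_w) − a:D_w`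
(`C_w` = central covariance of the window law) is `O(1)`, not `o(1)`; and a window-level counter-model passes every
window test EXACTLY — window law `N(ū, θ𝟙)` realised as a Gaussian time-mixture of anisotropic instantaneous laws
`N(m(s), θ𝟙 − A)`, record `J`-symmetric and above the floor, balance automatic — while the same-time cone stress
`ρ(θ𝟙 − A)` is anisotropic (the card's A2 temporal fibre, one level down).  With time width `r²` (any `o(r)`):
`|u_r(s) − ū_w| ≤ C r e_flat/ρ_w` on the window, `D_w = O(r² Λ²/ρ_min)` on warm non-dilute windows, and hot / dilute /
bad windows carry little energy (DensityCap + 9235 + Chebyshev, as the card says) — window covariance = instantaneous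
cone covariance + `o(1)` and the bookkeeping closes.  `OddContactSymmetryPW` / `RateFloorPW` below are re-typed with
`bt := (r²)⁻¹ (1 − |a|/r²)₊` (names kept; texts for the tenure planner's `--restate`; a window still holds
`≍ N^{4/3} r⁵ → ∞` collisions).

(B) `stub_parityStability` IS SPLIT INTO FIVE REGISTERED MEASURE-THEORY STUBS (§1c, §2), all self-contained statements
about measures on `ℝ³` / `(ℝ³×ℝ³)×S²`, provable now: `stub_exactParityRigidity` (the `η = 0` case: composition of the
landed chain p139072 → p138663 → p139366 → p137939), `stub_surprisalTestContinuity` (joint weak continuity of the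
Metropolis-odd functional at fixed `ϑ`), `stub_momentSemicontinuity` (moments along weakly convergent sequences),
`stub_countableTestUpgrade` (countable determining test families), `stub_parityStabilityOfRigidity` (Prokhorov +
contradiction); `parityStability_closed` composes them.  Tools in this tree's Mathlib (v4.32):
`isCompact_setOf_finiteMeasure_mass_le_compl_isCompact_le`, `isCompact_closure_of_isTightMeasureSet`,
`instMetrizableSpaceProbabilityMeasure`, `ext_of_forall_mem_subalgebra_integral_eq_of_polish`, `Measure.ext_of_charFun`,
`HasOuterApproxClosed` / `IsClosed.apprSeq`, `FiniteMeasure.normalize`, `tendsto_subseq_of_bounded`.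

THE CRUX. `ParityBandClosure := OddContactSymmetry → EvenStressEnskog → RateFloor → LocalSecondLaw → DensityCap →
_root_.HydrodynamicLimit` (the route's closure step; conclusion = the packing-guarded conjunct, `χ`-tested convergence
in probability at every `t ∈ [0,T)`).

THE LINE — THE PARITY CHAIN RUN WINDOW BY WINDOW (card `Lines/transfer-weighted-parity-chain.md`).  Grown from idea
`transfer-weighted-parity-chain` (triage r1 3/3 pass) against the dead line `Sketch` (`Lines/SketchDead.md`): the
transfer-weighting device turned out to be (i) unnecessary once the two kinetic hypotheses are stated POINTWISE AT
SCALE `r`, and (ii) insufficient under the typed fixed-`χ` hypotheses, where besides temporal Young mixing a second,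
DIAGONAL obstruction stands (the conclusion `WSI` is itself a scale-`r` statement: `∀η ∃r₀ ∀r ∃N₀`); what survives is
the parity chain itself, whose measure-level core is ENTIRELY LANDED (p139072 → p138663 → p139366 → p137939 →
p137300), run on INDIVIDUAL space–time windows at finite `N`, with NO limit objects, NO Skorokhod, NO Young measure:

* `stub_parityStability` (OWN, L, PROVABLE NOW from landed pieces + compactness): the single-pair QUANTITATIVE form of
  the landed chain — for every moment bound `M`, floor constant `cmin` and tolerance `ε` there are FINITELY MANY tests
  (odd marks `Ψ_j` at mollifier scales `ϑ_j ∈ (0,1)`, floor marks `Ξ_j ≥ 0`, balance tests `c_j`) and an `η > 0` such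
  that every pair (velocity law `ν`, collision record `κ`) passing those tests within `η` has `ε`-isotropic central
  second moments.  Contradiction + tightness (moments) ⇒ a limit pair with EXACT identities at every `ϑ` of a dense
  set ⇒ (continuity in `ϑ`) at all `ϑ ∈ (0,1)` ⇒ `stub_mapInverseCollisionOfOddIntegrals` ⇒ surprisal balance from
  windowed collision invariance with `c = log h_ϑ` (second moments of `κ`) ⇒ `stub_detailedBalanceOfSymmetricRecord`
  (`π = c₀(ν⊗ν)B dω ≪ κ` by the floor) ⇒ `stub_productionZeroOfDetailedBalance` for every `ϑ ∈ (0,1)` ⇒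
  `stub_isotropyOfVanishingProduction` ⇒ exact isotropy, contradicting `ε`; UI of second moments from the cubic bound.
* `stub_kineticHalf` (OWN, XL− bookkeeping, FINITE `N`, no new mathematics): `ParityStability → OddContactSymmetryPW →
  RateFloorPW → DensityCap → EnergyCurrentTails (9235) → LimitCollisionMeasure.CollisionTightness (13354) → WSI`: given
  `(a, g, η)`, take the lemma's finite data for `(M, cmin, ε)`; `r₀ :=` the least of the FINITELY many `r₀`'s of the
  hypotheses' instances; at `N ≥ N₀`, w.h.p. the windows violating some test by more than `η` have small measure
  (Chebyshev over windows: the PW hypotheses put `|·|` / `(·)₊` INSIDE the window integral; balance per window is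
  `empiricalEnskogIdentity_proof` with test `b_t b_x log ĥ_w`, error `O(N^{-1/3}/r)`); good windows have `ε`-isotropic
  window laws (the lemma); bad / dilute / high-moment windows carry little bulk energy (`DensityCap`, Markov from 13354's
  global bound) and little tail energy (9235); window stresses vs same-time cone stresses differ by a time average against
  the continuous `a` and by conserved (time-equicontinuous) fields only.
* `stub_inputs` (external): the four board items the LANDED pipeline consumes verbatim (9235, 13354, 13481, 13352) and the
  two RESTATED kinetic inputs `OddContactSymmetryPW` (17722 pointwise at scale `r`: tent-in-time × cone-in-space windows,
  `|·|` inside, the KDE reference law = the WINDOW's own space–time law, `ϑ` quantified OUTSIDE `∃r₀`) and `RateFloorPW`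
  (13080 pointwise at scale `r`, `(·)₊` inside, reference products taken AFTER space–time windowing — the two-time format
  of 13350 / the sister's `PointwiseEnskogCollisions`) — for the tenure planner to file (`route edit --restate`).

Downstream = the sister crux `ChaosClosesEuler`'s LANDED pipeline exactly as the dead line docked it: `WSI` +
`EvenStressEnskog` ⇒ `CPV` (p136561) ⇒ kinetic reduction p138091 ∘ BF18 shell p136414 (+ p133127, p108039, p97752) ⇒
time-averaged `L¹` closeness ⇒ weak readout p119530 ⇒ the conclusion BY NAME.

WHAT THIS SAYS ABOUT THE CRUX AS FILED (planner; card §A).  `OddContactSymmetry` (17722) and `RateFloor` (13080) AS TYPED are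
NOT consumed (nor the plain `LocalSecondLaw` 13081 — format, Disproof §5).  Corrected obstruction analysis: (A1) the dead
line's SPATIAL Young-mixing objection does not bind a sequentially organised limit (`N → ∞` first, `r → 0` inside one
limit measure by Lebesgue differentiation); (A2) but TEMPORAL mesoscopic oscillation of the law's SHAPE at fixed conserved
fields (time scales `N^{-1/3} ≪ ℓ_t ≪ 1`; the typed KDE `hm z s x₀ v` is instantaneous in `s`) realises the two-fibre
model p141493 in time against every fixed-`χ` hypothesis; (A3) and independently the DIAGONAL: `WSI` is a scale-`r`
statement, so fixed-`χ` identities must be used AT scale `r` with tolerance, which by compactness leads back to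
cone-content Young measures with averaged identities — the sister lead's R1 verdict is right in substance for every
scale-`r` conclusion.  Both dissolve when the two kinetic hypotheses carry the window INSIDE the absolute value; then the
rigidity needed is exactly the landed chain, quantitatively.  Precedent for the shape (unconsumed antecedents, restated
inputs in `stub_inputs`): the sister's registered v11 (`_hCC`, `_hLSL`, `PointwiseLocalEquilibrium/EnskogCollisions`).

DISPROOF USED. `Cruxes/ParityBandClosure/Disproof.lean` cycle 1: §1 (`not_parityBandClosure_iff`: all stubs are proof
devices; none restates the crux or the Statement; §2: no `_false_without_<H>` can exist for this closed implication, so the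
unconsumed `hO/hR/hL` contradict no landed negative); §3 (the line uses `DensityCap` as typed = `InformationPercolationEngine.
DensityCap`, under the conclusion's own guard); §5 (`not_isEntropyCutoff_id`, `total_entropy_balance_not_renormalised`:
the Grönwall takes the CLAMPED 13352); §6 junk audit (recorded configuration OUTGOING, `pv` = PRE pair: the PW marks are
evaluated at `pv`; `F` is a log-RATIO, invariant under the window-mass normalisation, so truncated windows at the time ends
are harmless, and on the floor side they only halve the constant `g₀`); §7 Targets: none.  Landed negative imported and
checked: `youngMixing_twoFibre_counterModel` (p141493) — `ParityStability` concerns ONE law with ONE surprisal and an EXACTLY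
(in the limit) `J`-invariant reweighted record; the toy's summed two-surprisal record is not an instance (its own item (v)).

`ParityBandClosure_of : JParityClosure.ParityBandClosure` is PROVED below from the three stubs by pure logic + landed theorems.
-/

noncomputable section

namespace Summit.AtomisticToContinuum.HydrodynamicLimit.Cruxes.ParityBandClosure.TransferWeightedParityChain

open scoped BigOperators Topology Classical MeasureTheory ENNReal InnerProductSpace
open Filter Set MeasureTheory
open Literature.MathematicalPhysics.KineticTheory
open Literature.Analysis.FluidPDE
open Summit.AtomisticToContinuum.HydrodynamicLimit.Theses

/-! ## §1 Typed waypoints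

### §1a The sister pipeline's interfaces (bodies VERBATIM `Cruxes/ChaosClosesEuler/Lines/Sketch.lean` v11 = the dead line's copies) -/

/-- **Uniform integrability of the quadratic collision mark** (sister `CollisionMomentUI`, verbatim); from
`LimitCollisionMeasure.CollisionTightness` (13354) by the landed `ChaosClosesEulerCollisionMomentUI.stub_collisionMomentUI`. -/
def CollisionMomentUI : Prop :=
  ∀ (a₀ θ₀ : T3 → ℝ) (u₀ : T3 → V3), Continuous a₀ → Continuous θ₀ → Continuous u₀ →
    (∀ x, 0 < a₀ x) → (∀ x, 0 < θ₀ x) → ∃ σ₀ : ℝ, 0 < σ₀ ∧ ∀ σ : ℝ, 0 < σ → σ < σ₀ →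
    ∀ Φ : (N : ℕ) → HardSphereFlow (Torus.geometry (Fin 3)) (hsDiameter σ N) (N + 1),
    ∀ τ : ℝ, 0 < τ → ∀ η δ : ℝ, 0 < η → 0 < δ → ∃ L : ℝ, ∃ N₀ : ℕ, ∀ N : ℕ, N₀ ≤ N →
    let ε := hsDiameter σ N
    let G : Geometry (Fin 3) T3 := Torus.geometry (Fin 3)
    let γ : Config (N + 1) (Fin 3) T3 → ℝ → Config (N + 1) (Fin 3) T3 := fun z s => (Φ N).flow s z
    let Kc : (Config (N + 1) (Fin 3) T3 → ℝ → Fin (N + 1) → Fin (N + 1) → ℝ) → Config (N + 1) (Fin 3) T3 → ℝ := fun F z =>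
      ε / (N + 1 : ℝ) * ∑ᶠ (s : ℝ) (_ : s ∈ collisionTimes G ε (γ z) ∩ Set.Icc 0 τ),
        ∑ i : Fin (N + 1), ∑ j : Fin (N + 1),
          (if i ≠ j ∧ ‖G.sepVec (γ z s i).1 (γ z s j).1‖ = ε then F z s i j else 0)
    localGibbsLaw σ a₀ u₀ θ₀ N (Φ N)
        {z | η < Kc (fun z s i j => if L < ‖(γ z s i).2‖ ^ 2 + ‖(γ z s j).2‖ ^ 2 then
          1 + ‖(γ z s i).2‖ ^ 2 + ‖(γ z s j).2‖ ^ 2 else 0) z} ≤ ENNReal.ofReal δ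

/-- **Weak isotropy of the local pressure tensor, in band, pre-shock** (sister `WeakStressIsotropyInBand`, verbatim) — a
SCALE-`r` statement (`∀η ∃r₀ ∀r<r₀ ∃N₀`); in THIS line the output of `stub_kineticHalf`. -/
def WeakStressIsotropyInBand : Prop :=
  ∃ η₀ : ℝ, 0 < η₀ ∧ ∀ (a₀ θ₀ : T3 → ℝ) (u₀ : T3 → V3), Continuous a₀ → Continuous θ₀ → Continuous u₀ →
    (∀ x, 0 < a₀ x) → (∀ x, 0 < θ₀ x) → ∃ σ₀ : ℝ, 0 < σ₀ ∧ ∀ σ : ℝ, 0 < σ → σ < σ₀ →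
    ∀ (T : ℝ) (ρ θ : ℝ → T3 → ℝ) (u : ℝ → T3 → V3), IsHardSphereEulerSolution σ T ρ u θ →
    ∀ Φ : (N : ℕ) → HardSphereFlow (Torus.geometry (Fin 3)) (hsDiameter σ N) (N + 1),
    TendstoHydroFieldsAt (fun N => localGibbsLaw σ a₀ u₀ θ₀ N (Φ N)) Φ ρ u θ 0 →
    ∀ t ∈ Set.Ico 0 T, ∀ a : Fin 3 → Fin 3 → ℝ × T3 → ℝ, (∀ j k, Continuous (a j k)) →
    (∀ p, ∑ j : Fin 3, a j j p = 0) →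
    ∀ g : ℝ → ℝ, Continuous g → (∀ b, η₀ ≤ b → g b = 0) →
    ∀ η δ : ℝ, 0 < η → 0 < δ → ∃ r₀ : ℝ, 0 < r₀ ∧ ∀ r : ℝ, 0 < r → r < r₀ → ∃ N₀ : ℕ, ∀ N : ℕ, N₀ ≤ N →
    let bx : T3 → T3 → ℝ := fun y x => 3 / (Real.pi * r ^ 3) * max (1 - Torus.euclidDist y x / r) 0
    let ρm : Config (N + 1) (Fin 3) T3 → T3 → ℝ := fun w x₀ => ∫ q, bx q.1 x₀ ∂(empiricalMeasure w)
    let mm : Config (N + 1) (Fin 3) T3 → T3 → V3 := fun w x₀ => ∫ q, bx q.1 x₀ • q.2 ∂(empiricalMeasure w)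
    let Pm : Config (N + 1) (Fin 3) T3 → T3 → Fin 3 → Fin 3 → ℝ := fun w x₀ j k =>
      (∫ q, bx q.1 x₀ * (q.2 j * q.2 k) ∂(empiricalMeasure w)) - mm w x₀ j * mm w x₀ k / ρm w x₀
    localGibbsLaw σ a₀ u₀ θ₀ N (Φ N)
      {z | η < |∫ s in Set.Icc 0 t, ∫ x, g (σ ^ 3 * ρm ((Φ N).flow s z) x) *
        ∑ j : Fin 3, ∑ k : Fin 3, a j k (s, x) * Pm ((Φ N).flow s z) x j k|} ≤ ENNReal.ofReal δ

/-- **Collisional pressure value, in band, pre-shock** (sister `CollisionalPressureValueInBand`, verbatim); here from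
`EvenStressEnskog` + `WSI` by the LANDED exact algebra p136561. -/
def CollisionalPressureValueInBand : Prop :=
  ∃ η₀ : ℝ, 0 < η₀ ∧ ∀ (a₀ θ₀ : T3 → ℝ) (u₀ : T3 → V3), Continuous a₀ → Continuous θ₀ → Continuous u₀ →
    (∀ x, 0 < a₀ x) → (∀ x, 0 < θ₀ x) → ∃ σ₀ : ℝ, 0 < σ₀ ∧ ∀ σ : ℝ, 0 < σ → σ < σ₀ →
    ∀ (T : ℝ) (ρ θ : ℝ → T3 → ℝ) (u : ℝ → T3 → V3), IsHardSphereEulerSolution σ T ρ u θ →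
    ∀ Φ : (N : ℕ) → HardSphereFlow (Torus.geometry (Fin 3)) (hsDiameter σ N) (N + 1),
    TendstoHydroFieldsAt (fun N => localGibbsLaw σ a₀ u₀ θ₀ N (Φ N)) Φ ρ u θ 0 →
    ∀ t ∈ Set.Ico 0 T, ∀ a : Fin 3 → Fin 3 → ℝ × T3 → ℝ, (∀ j k, Continuous (a j k)) →
    (∀ j k p, a j k p = a k j p) →
    ∀ g : ℝ → ℝ, Continuous g → (∀ b, η₀ ≤ b → g b = 0) →
    ∀ η δ : ℝ, 0 < η → 0 < δ → ∃ r₀ : ℝ, 0 < r₀ ∧ ∀ r : ℝ, 0 < r → r < r₀ → ∃ N₀ : ℕ, ∀ N : ℕ, N₀ ≤ N →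
    let ε := hsDiameter σ N
    let G : Geometry (Fin 3) T3 := Torus.geometry (Fin 3)
    let γ : Config (N + 1) (Fin 3) T3 → ℝ → Config (N + 1) (Fin 3) T3 := fun z s => (Φ N).flow s z
    let bx : T3 → T3 → ℝ := fun y x => 3 / (Real.pi * r ^ 3) * max (1 - Torus.euclidDist y x / r) 0
    let ρm : Config (N + 1) (Fin 3) T3 → T3 → ℝ := fun w x₀ => ∫ q, bx q.1 x₀ ∂(empiricalMeasure w)
    let mm : Config (N + 1) (Fin 3) T3 → T3 → V3 := fun w x₀ => ∫ q, bx q.1 x₀ • q.2 ∂(empiricalMeasure w)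
    let em : Config (N + 1) (Fin 3) T3 → T3 → ℝ := fun w x₀ =>
      ∫ q, bx q.1 x₀ * (‖q.2‖ ^ 2 / 2) ∂(empiricalMeasure w)
    let θm : Config (N + 1) (Fin 3) T3 → T3 → ℝ := fun w x₀ =>
      2 / 3 * (em w x₀ / ρm w x₀ - ‖mm w x₀‖ ^ 2 / (2 * ρm w x₀ ^ 2))
    let pv : Config (N + 1) (Fin 3) T3 → ℝ → Fin (N + 1) → Fin (N + 1) → V3 × V3 := fun z s i j =>
      reflectVel (G.sepVec (γ z s i).1 (γ z s j).1) ((γ z s i).2, (γ z s j).2)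
    let Kc : (Config (N + 1) (Fin 3) T3 → ℝ → Fin (N + 1) → Fin (N + 1) → ℝ) → Config (N + 1) (Fin 3) T3 → ℝ := fun F z =>
      ε / (N + 1 : ℝ) * ∑ᶠ (s : ℝ) (_ : s ∈ collisionTimes G ε (γ z) ∩ Set.Icc 0 t),
        ∑ i : Fin (N + 1), ∑ j : Fin (N + 1),
          (if i ≠ j ∧ ‖G.sepVec (γ z s i).1 (γ z s j).1‖ = ε then F z s i j else 0)
    let D : Config (N + 1) (Fin 3) T3 → ℝ := fun z =>
      Kc (fun z s i j =>
          g (σ ^ 3 * ρm (γ z s) (γ z s i).1) *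
            |⟪(pv z s i j).1 - (pv z s i j).2, ε⁻¹ • G.sepVec (γ z s i).1 (γ z s j).1⟫_ℝ| *
            ∑ k : Fin 3, ∑ l : Fin 3, a k l (s, (γ z s i).1) *
              ((ε⁻¹ • G.sepVec (γ z s i).1 (γ z s j).1) k * (ε⁻¹ • G.sepVec (γ z s i).1 (γ z s j).1) l)) z
        - 2 * ∫ s in Set.Icc 0 t, ∫ x, g (σ ^ 3 * ρm (γ z s) x) *
            (hsPressure σ (ρm (γ z s) x) (θm (γ z s) x) - ρm (γ z s) x * θm (γ z s) x) *
            ∑ k : Fin 3, a k k (s, x)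
    localGibbsLaw σ a₀ u₀ θ₀ N (Φ N) {z | η < |D z|} ≤ ENNReal.ofReal δ

/-- **Mollified fields close in TIME AVERAGE** (sister `MollifiedCloseTimeAveraged`, verbatim): output of the landed Grönwall,
input of the landed weak readout. -/
def MollifiedCloseTimeAveraged : Prop :=
  ∃ η₀ : ℝ, 0 < η₀ ∧ ∀ (a₀ θ₀ : T3 → ℝ) (u₀ : T3 → V3), Continuous a₀ → Continuous θ₀ → Continuous u₀ →
    (∀ x, 0 < a₀ x) → (∀ x, 0 < θ₀ x) → ∃ σ₀ : ℝ, 0 < σ₀ ∧ ∀ σ : ℝ, 0 < σ → σ < σ₀ →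
    ∀ (T : ℝ) (ρ θ : ℝ → T3 → ℝ) (u : ℝ → T3 → V3), IsHardSphereEulerSolution σ T ρ u θ →
    (∀ t ∈ Set.Ico 0 T, ∀ x, ρ t x * σ ^ 3 < η₀) →
    ∀ Φ : (N : ℕ) → HardSphereFlow (Torus.geometry (Fin 3)) (hsDiameter σ N) (N + 1),
    TendstoHydroFieldsAt (fun N => localGibbsLaw σ a₀ u₀ θ₀ N (Φ N)) Φ ρ u θ 0 →
    ∀ t ∈ Set.Ico 0 T, ∀ Δ : ℝ, 0 < Δ → t + Δ < T → ∀ η δ : ℝ, 0 < η → 0 < δ →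
    ∃ r₀ : ℝ, 0 < r₀ ∧ ∀ r : ℝ, 0 < r → r < r₀ → ∃ N₀ : ℕ, ∀ N : ℕ, N₀ ≤ N →
    let bx : T3 → T3 → ℝ := fun y x => 3 / (Real.pi * r ^ 3) * max (1 - Torus.euclidDist y x / r) 0
    localGibbsLaw σ a₀ u₀ θ₀ N (Φ N)
        {z | η * Δ < ∫ s in Set.Icc t (t + Δ),
          ((∫ x, |empiricalDensityField ((Φ N).flow s z) (fun y => bx y x) - ρ s x|)
          + (∫ x, ‖empiricalMomentumField ((Φ N).flow s z) (fun y => bx y x) - ρ s x • u s x‖)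
          + ∫ x, |empiricalEnergyField ((Φ N).flow s z) (fun y => bx y x) -
              totalEnergyDensity (ρ s x) (u s x) (θ s x)|)} ≤ ENNReal.ofReal δ

/-! ### §1b The two restated kinetic inputs (for the tenure planner) and the stability lemma -/

/-- **`OddContactSymmetry` POINTWISE AT SCALE `r`** (restatement of 17722; frame, cut-off class, mark class, Metropolis
weight, `Kc` normalisation and the `pv`/`ε⁻¹sepVec` conventions VERBATIM the route decl; three changes, each forced by
the card's §A2/§A3, plus v3 (A)): (1) the fixed localiser `χ(s,x)` is replaced by tent-in-time × cone-in-space WINDOWS —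
time width `r²` (v3; v2 had `r`, which leaves an `O(1)` within-window bulk-velocity fluctuation, file header (A)), space
width `r` — at `(t₀,x₀)` with the absolute value INSIDE the `dt₀ dx₀` integral (`∫∫ g(σ³ρ_w)|K_w| dt₀dx₀ → 0` in probability); (2) the
surprisal jump `F` of a collision in the window is read off the WINDOW's own space–time `(r², r, ϑ)`-mollified law `hw`
(one reference law per window — a continuous functional of the space–time empirical measure); (3) `ϑ ∈ (0,1)` is
quantified BEFORE `η` (so finitely many `(Ψ, ϑ)` instances share an `r₀`; SketchDead remark (1): with `ϑ` outside, even
their toy dies by analyticity).  Same physical claim as 17722 (the Metropolis-reweighted incoming contact record of a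
pre-shock window is symmetric under the inverse collision), same tightness (`0 < min(1,e^{−F}) ≤ 1`); `|·|` inside costs
only the per-window LLN (a window holds `≍ N^{4/3} r⁴ → ∞` collisions); fixed `ϑ` is KDE-friendlier than the typed
`ϑ < r₀(η)` (no joint bandwidth limit).  `g ≥ 0` (signed cut-offs split as `g₊ − g₋`). -/
def OddContactSymmetryPW : Prop :=
  ∃ η₀ : ℝ, 0 < η₀ ∧ ∀ (a₀ θ₀ : Literature.MathematicalPhysics.KineticTheory.T3 → ℝ) (u₀ : Literature.MathematicalPhysics.KineticTheory.T3 → Literature.MathematicalPhysics.KineticTheory.V3), Continuous a₀ → Continuous θ₀ → Continuous u₀ → (∀ x, 0 < a₀ x) → (∀ x, 0 < θ₀ x) → ∃ σ₀ : ℝ, 0 < σ₀ ∧ ∀ σ : ℝ, 0 < σ → σ < σ₀ → ∀ (T : ℝ) (ρ θ : ℝ → Literature.MathematicalPhysics.KineticTheory.T3 → ℝ) (u : ℝ → Literature.MathematicalPhysics.KineticTheory.T3 → Literature.MathematicalPhysics.KineticTheory.V3), Literature.MathematicalPhysics.KineticTheory.IsHardSphereEulerSolution σ T ρ u θ → ∀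 Φ : (N : ℕ) → Literature.Analysis.FluidPDE.HardSphereFlow (Literature.Analysis.FluidPDE.Torus.geometry (Fin 3)) (Literature.MathematicalPhysics.KineticTheory.hsDiameter σ N) (N + 1), Literature.MathematicalPhysics.KineticTheory.TendstoHydroFieldsAt (fun N => Literature.MathematicalPhysics.KineticTheory.localGibbsLaw σ a₀ u₀ θ₀ N (Φ N)) Φ ρ u θ 0 → ∀ τ : ℝ, 0 < τ → τ < T → ∀ g : ℝ → ℝ, Continuous g → (∀ a, η₀ ≤ a → g a = 0) → (∀ a, 0 ≤ g a) → ∀ Ψ : EuclideanSpace ℝ (Fin 3) × EuclideanSpace ℝ (Fin 3) × EuclideanSpace ℝ (Fin 3) → ℝ, Continuous Ψ → (∃ C : ℝ, ∀ q, |Ψ q| ≤ C) → (∀ (n v w : EuclideanSpace ℝ (Fin 3)), ‖n‖ = 1 → Ψ (-n, (Literature.Analysis.FluidPDE.reflectVel n (v, w)).1, (Literature.Analysis.FluidPDE.reflectVel n (v, w)).2) = -Ψ (n, v, w)) → ∀ ϑ : ℝ, 0 < ϑ → ϑ < 1 → ∀ η δ : ℝ, 0 < η → 0 < δ → ∃ r₀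 : ℝ, 0 < r₀ ∧ ∀ r : ℝ, 0 < r → r < r₀ → ∃ N₀ : ℕ, ∀ N : ℕ, N₀ ≤ N →
    let ε := Literature.MathematicalPhysics.KineticTheory.hsDiameter σ N
    let G : Literature.Analysis.FluidPDE.Geometry (Fin 3) Literature.MathematicalPhysics.KineticTheory.T3 := Literature.Analysis.FluidPDE.Torus.geometry (Fin 3)
    let γ : Literature.Analysis.FluidPDE.Config (N + 1) (Fin 3) Literature.MathematicalPhysics.KineticTheory.T3 → ℝ → Literature.Analysis.FluidPDE.Config (N + 1) (Fin 3) Literature.MathematicalPhysics.KineticTheory.T3 := fun z s => (Φ N).flow s z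
    let bx : Literature.MathematicalPhysics.KineticTheory.T3 → Literature.MathematicalPhysics.KineticTheory.T3 → ℝ := fun y x₀ => 3 / (Real.pi * r ^ 3) * max (1 - Literature.Analysis.FluidPDE.Torus.euclidDist y x₀ / r) 0
    let bt : ℝ → ℝ := fun a => (r ^ 2)⁻¹ * max (1 - |a| / r ^ 2) 0
    let ρw : Literature.Analysis.FluidPDE.Config (N + 1) (Fin 3) Literature.MathematicalPhysics.KineticTheory.T3 → ℝ → Literature.MathematicalPhysics.KineticTheory.T3 → ℝ := fun z t₀ x₀ =>
      ∫ s in Set.Icc (0 : ℝ) τ, bt (s - t₀) * ∫ q, bx q.1 x₀ ∂(Literature.Analysis.FluidPDE.empiricalMeasure (γ z s))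
    let hw : Literature.Analysis.FluidPDE.Config (N + 1) (Fin 3) Literature.MathematicalPhysics.KineticTheory.T3 → ℝ → Literature.MathematicalPhysics.KineticTheory.T3 → Literature.MathematicalPhysics.KineticTheory.V3 → ℝ := fun z t₀ x₀ v =>
      ∫ s in Set.Icc (0 : ℝ) τ, bt (s - t₀) * ∫ q, bx q.1 x₀ * Literature.Analysis.FluidPDE.localMaxwellian 1 (ϑ ^ 2) v q.2 ∂(Literature.Analysis.FluidPDE.empiricalMeasure (γ z s))
    let pv : Literature.Analysis.FluidPDE.Config (N + 1) (Fin 3) Literature.MathematicalPhysics.KineticTheory.T3 → ℝ → Fin (N + 1) → Fin (N + 1) → Literature.MathematicalPhysics.KineticTheory.V3 × Literature.MathematicalPhysics.KineticTheory.V3 := fun z s i j =>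
      Literature.Analysis.FluidPDE.reflectVel (G.sepVec (γ z s i).1 (γ z s j).1) ((γ z s i).2, (γ z s j).2)
    let F : Literature.Analysis.FluidPDE.Config (N + 1) (Fin 3) Literature.MathematicalPhysics.KineticTheory.T3 → ℝ → Literature.MathematicalPhysics.KineticTheory.T3 → ℝ → Fin (N + 1) → Fin (N + 1) → ℝ := fun z t₀ x₀ s i j =>
      Real.log (hw z t₀ x₀ (pv z s i j).1) + Real.log (hw z t₀ x₀ (pv z s i j).2) -
        Real.log (hw z t₀ x₀ (γ z s i).2) - Real.log (hw z t₀ x₀ (γ z s j).2)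
    let Kw : Literature.Analysis.FluidPDE.Config (N + 1) (Fin 3) Literature.MathematicalPhysics.KineticTheory.T3 → ℝ → Literature.MathematicalPhysics.KineticTheory.T3 → ℝ := fun z t₀ x₀ =>
      ε / (N + 1 : ℝ) * ∑ᶠ (s : ℝ) (_ : s ∈ Literature.Analysis.FluidPDE.collisionTimes G ε (γ z) ∩ Set.Icc 0 τ),
        ∑ i : Fin (N + 1), ∑ j : Fin (N + 1),
          (if i ≠ j ∧ ‖G.sepVec (γ z s i).1 (γ z s j).1‖ = ε then
            bt (s - t₀) * bx (γ z s i).1 x₀ *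
              (Ψ (ε⁻¹ • G.sepVec (γ z s i).1 (γ z s j).1, (pv z s i j).1, (pv z s i j).2) *
                min 1 (Real.exp (-F z t₀ x₀ s i j))) else 0)
    let D : Literature.Analysis.FluidPDE.Config (N + 1) (Fin 3) Literature.MathematicalPhysics.KineticTheory.T3 → ℝ := fun z =>
      ∫ t₀ in Set.Icc (0 : ℝ) τ, ∫ x₀ : Literature.MathematicalPhysics.KineticTheory.T3, g (σ ^ 3 * ρw z t₀ x₀) * |Kw z t₀ x₀|
    Literature.MathematicalPhysics.KineticTheory.localGibbsLaw σ a₀ u₀ θ₀ N (Φ N) {z | η < D z} ≤ ENNReal.ofReal δ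

/-- **`RateFloor` POINTWISE AT SCALE `r` WITH TWO-TIME PRODUCTS** (restatement of 13080 = SketchDead's R-b in the two-time
format of 13350 / `PointwiseEnskogCollisions`; frame, mark class, `Θ`, `Kc` and `pv` conventions VERBATIM the route decl):
the fixed `χ` is replaced by windows at `(t₀,x₀)` (time width `r²` — v3 (A) — space width `r`) with the positive part `(g₀σ³B_w − K_w)₊` INSIDE the `dt₀dx₀` integral,
and the reference pair functional `B_w` pairs the WINDOW's space–time law with itself (products AFTER windowing: a
double time integral against `bt ⊗ bt`).  Limit content per window: `κ_w ≥ g₀σ³ρ_w²·Θ[ν_w⊗ν_w]` for the window law `ν_w`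
itself — the `π ≪ κ` that `stub_detailedBalanceOfSymmetricRecord` consumes; the typed same-time product gives only the
fibre average `∫Λ(dν)ν⊗ν`, a weaker floor for `|v−w|`-type kernels (sister NOTES §F2).  Windows truncated at the time
ends lose at most half their mass on the K-side against a quarter on the reference side: absorbed in `g₀`. -/
def RateFloorPW : Prop :=
  ∃ g₀ : ℝ, 0 < g₀ ∧ ∀ (a₀ θ₀ : Literature.MathematicalPhysics.KineticTheory.T3 → ℝ) (u₀ : Literature.MathematicalPhysics.KineticTheory.T3 → Literature.MathematicalPhysics.KineticTheory.V3), Continuous a₀ → Continuous θ₀ → Continuous u₀ → (∀ x, 0 < a₀ x) → (∀ x, 0 < θ₀ x) → ∃ σ₀ : ℝ, 0 < σ₀ ∧ ∀ σ : ℝ, 0 < σ → σ < σ₀ → ∀ Φ : (N : ℕ) → Literature.Analysis.FluidPDE.HardSphereFlow (Literature.Analysis.FluidPDE.Torus.geometry (Fin 3)) (Literature.MathematicalPhysics.KineticTheory.hsDiameter σ N) (N + 1), ∀ τ : ℝ, 0 < τ → ∀ Ξ : EuclideanSpace ℝ (Fin 3) × EuclideanSpace ℝ (Fin 3) × EuclideanSpace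 ℝ (Fin 3) → ℝ, Continuous Ξ → (∀ q, 0 ≤ Ξ q) → (∃ C : ℝ, ∀ q, Ξ q ≤ C) → ∀ η δ : ℝ, 0 < η → 0 < δ → ∃ r₀ : ℝ, 0 < r₀ ∧ ∀ r : ℝ, 0 < r → r < r₀ → ∃ N₀ : ℕ, ∀ N : ℕ, N₀ ≤ N →
    let ε := Literature.MathematicalPhysics.KineticTheory.hsDiameter σ N
    let G : Literature.Analysis.FluidPDE.Geometry (Fin 3) Literature.MathematicalPhysics.KineticTheory.T3 := Literature.Analysis.FluidPDE.Torus.geometry (Fin 3)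
    let γ : Literature.Analysis.FluidPDE.Config (N + 1) (Fin 3) Literature.MathematicalPhysics.KineticTheory.T3 → ℝ → Literature.Analysis.FluidPDE.Config (N + 1) (Fin 3) Literature.MathematicalPhysics.KineticTheory.T3 := fun z s => (Φ N).flow s z
    let bx : Literature.MathematicalPhysics.KineticTheory.T3 → Literature.MathematicalPhysics.KineticTheory.T3 → ℝ := fun y x₀ => 3 / (Real.pi * r ^ 3) * max (1 - Literature.Analysis.FluidPDE.Torus.euclidDist y x₀ / r) 0
    let bt : ℝ → ℝ := fun a => (r ^ 2)⁻¹ * max (1 - |a| / r ^ 2) 0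
    let Θ : Literature.MathematicalPhysics.KineticTheory.V3 → Literature.MathematicalPhysics.KineticTheory.V3 → ℝ := fun v w =>
      ∫ ω : Metric.sphere (0 : Literature.MathematicalPhysics.KineticTheory.V3) 1, Ξ ((ω : Literature.MathematicalPhysics.KineticTheory.V3), v, w) * Literature.MathematicalPhysics.KineticTheory.hardSphereKernel (w, v) ω ∂Literature.MathematicalPhysics.KineticTheory.sphereMeasure
    let Bw : Literature.Analysis.FluidPDE.Config (N + 1) (Fin 3) Literature.MathematicalPhysics.KineticTheory.T3 → ℝ → Literature.MathematicalPhysics.KineticTheory.T3 → ℝ := fun z t₀ x₀ =>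
      ∫ s₁ in Set.Icc (0 : ℝ) τ, ∫ s₂ in Set.Icc (0 : ℝ) τ, bt (s₁ - t₀) * bt (s₂ - t₀) *
        ∫ p, bx p.1.1 x₀ * bx p.2.1 x₀ * Θ p.1.2 p.2.2 ∂((Literature.Analysis.FluidPDE.empiricalMeasure (γ z s₁)).prod (Literature.Analysis.FluidPDE.empiricalMeasure (γ z s₂)))
    let pv : Literature.Analysis.FluidPDE.Config (N + 1) (Fin 3) Literature.MathematicalPhysics.KineticTheory.T3 → ℝ → Fin (N + 1) → Fin (N + 1) → Literature.MathematicalPhysics.KineticTheory.V3 × Literature.MathematicalPhysics.KineticTheory.V3 := fun z s i j =>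
      Literature.Analysis.FluidPDE.reflectVel (G.sepVec (γ z s i).1 (γ z s j).1) ((γ z s i).2, (γ z s j).2)
    let Kw : Literature.Analysis.FluidPDE.Config (N + 1) (Fin 3) Literature.MathematicalPhysics.KineticTheory.T3 → ℝ → Literature.MathematicalPhysics.KineticTheory.T3 → ℝ := fun z t₀ x₀ =>
      ε / (N + 1 : ℝ) * ∑ᶠ (s : ℝ) (_ : s ∈ Literature.Analysis.FluidPDE.collisionTimes G ε (γ z) ∩ Set.Icc 0 τ),
        ∑ i : Fin (N + 1), ∑ j : Fin (N + 1),
          (if i ≠ j ∧ ‖G.sepVec (γ z s i).1 (γ z s j).1‖ = ε then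
            bt (s - t₀) * bx (γ z s i).1 x₀ *
              Ξ (ε⁻¹ • G.sepVec (γ z s i).1 (γ z s j).1, (pv z s i j).1, (pv z s i j).2) else 0)
    let D : Literature.Analysis.FluidPDE.Config (N + 1) (Fin 3) Literature.MathematicalPhysics.KineticTheory.T3 → ℝ := fun z =>
      ∫ t₀ in Set.Icc (0 : ℝ) τ, ∫ x₀ : Literature.MathematicalPhysics.KineticTheory.T3, max (g₀ * σ ^ 3 * Bw z t₀ x₀ - Kw z t₀ x₀) 0
    Literature.MathematicalPhysics.KineticTheory.localGibbsLaw σ a₀ u₀ θ₀ N (Φ N) {z | η < D z} ≤ ENNReal.ofReal δ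

/-- **Parity stability (single pair, quantitative; the landed measure-level chain made uniform).**  For every moment
bound `M`, floor constant `cmin > 0` and `ε > 0` there are finitely many tests — bounded continuous `J`-odd marks `Ψ_j`
(`J(p,ω) = (collide ω p, −ω)`) with mollifier scales `ϑ_j ∈ (0,1)`, bounded continuous floor marks `Ξ_j ≥ 0`, bounded
continuous balance tests `c_j` — and `η > 0` such that: whenever a probability law `ν` on `ℝ³` (`∫|v|³ ≤ M`) and a finite
record `κ` on `(ℝ³×ℝ³)×S²` (mass and second moments `≤ M`) satisfy (o) `|∫Ψ_j min(1,e^{−F^ν_{ϑ_j}}) dκ| ≤ η`,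
(f) `c₀∫Ξ_j B d(ν⊗ν⊗dω) ≤ ∫Ξ_j dκ + η` with `c₀ ≥ cmin`, (b) `|∫Δc_j dκ| ≤ η`, then the central second-moment tensor of `ν`
is `ε`-close to `θ𝟙` for some `θ ≥ 0`.  `F^ν_ϑ(p,ω) = log h(p.1)h(p.2) − log h(p′.1)h(p′.2)`, `h = ν ⋆ G_{ϑ²}`, `p′ = collide ω p`,
`B = hardSphereKernel (w, v) ω = ((w−v)·ω)₊` — VERBATIM the conventions of `ParityRigidity` / p138663 / p139366.  Proof route in
the file header (contradiction + tightness + continuity of `(ν,κ) ↦ ∫Ψ min(1,e^{−F^ν_ϑ})dκ` at FIXED `ϑ > 0` + the landed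
chain at every `ϑ ∈ (0,1)`).  Satisfiable hypotheses for every choice of tests (Maxwellian `ν`, `κ = c₀(ν⊗ν)B dω`), so the
`∃`-data cannot be gamed. -/
def ParityStability : Prop :=
  ∀ (M cmin ε : ℝ), 0 < cmin → 0 < ε →
    ∃ (n : ℕ) (Ψs : Fin n → (V3 × V3) × Metric.sphere (0 : V3) 1 → ℝ)
      (Ξs : Fin n → (V3 × V3) × Metric.sphere (0 : V3) 1 → ℝ) (cs : Fin n → V3 → ℝ) (ϑs : Fin n → ℝ) (η : ℝ),
      0 < η ∧
      (∀ j, Continuous (Ψs j) ∧ (∃ C : ℝ, ∀ q, |Ψs j q| ≤ C) ∧ (∀ q, Ψs j (collide q.2 q.1, -q.2) = -Ψs j q)) ∧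
      (∀ j, Continuous (Ξs j) ∧ (∀ q, 0 ≤ Ξs j q) ∧ (∃ C : ℝ, ∀ q, Ξs j q ≤ C)) ∧
      (∀ j, Continuous (cs j) ∧ (∃ C : ℝ, ∀ v, |cs j v| ≤ C)) ∧
      (∀ j, 0 < ϑs j ∧ ϑs j < 1) ∧
      ∀ (ν : Measure V3) [IsProbabilityMeasure ν] (κ : Measure ((V3 × V3) × Metric.sphere (0 : V3) 1))
        [IsFiniteMeasure κ] (c₀ : ℝ), cmin ≤ c₀ →
        Integrable (fun v : V3 => ‖v‖ ^ 3) ν → ∫ v, ‖v‖ ^ 3 ∂ν ≤ M →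
        (κ Set.univ).toReal ≤ M →
        Integrable (fun q : (V3 × V3) × Metric.sphere (0 : V3) 1 => ‖q.1.1‖ ^ 2 + ‖q.1.2‖ ^ 2) κ →
        ∫ q, (‖q.1.1‖ ^ 2 + ‖q.1.2‖ ^ 2) ∂κ ≤ M →
        let h : ℝ → V3 → ℝ := fun ϑ v => ∫ v', localMaxwellian 1 (ϑ ^ 2) v v' ∂ν
        let F : ℝ → (V3 × V3) × Metric.sphere (0 : V3) 1 → ℝ := fun ϑ q =>
          Real.log (h ϑ q.1.1) + Real.log (h ϑ q.1.2) -
            Real.log (h ϑ (collide q.2 q.1).1) - Real.log (h ϑ (collide q.2 q.1).2)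
        (∀ j, |∫ q, Ψs j q * min 1 (Real.exp (-(F (ϑs j) q))) ∂κ| ≤ η) →
        (∀ j, c₀ * ∫ q, Ξs j q * hardSphereKernel (q.1.2, q.1.1) q.2 ∂((ν.prod ν).prod sphereMeasure) ≤
          (∫ q, Ξs j q ∂κ) + η) →
        (∀ j, |∫ q, (cs j (collide q.2 q.1).1 + cs j (collide q.2 q.1).2 - cs j q.1.1 - cs j q.1.2) ∂κ| ≤ η) →
        ∃ θ : ℝ, 0 ≤ θ ∧ ∃ u : V3, (∀ j : Fin 3, |(∫ v, v j ∂ν) - u j| ≤ ε) ∧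
          ∀ j k : Fin 3, |(∫ v, (v j - u j) * (v k - u k) ∂ν) - (if j = k then θ else 0)| ≤ ε

/-! ### §1c The four measure-theoretic waypoints of `ParityStability` (v3 (B); all on `ℝ³` / `Q := (ℝ³×ℝ³)×S²`)

Conventions shared by all four (VERBATIM those of `ParityStability`, `ParityRigidity`, p138663, p139366, p137939):
`h^ν_ϑ(v) = ∫ localMaxwellian 1 ϑ² v v' dν(v')` (Gaussian KDE of the law `ν` at bandwidth `ϑ`),
`F^ν_ϑ(q) = log h(q.1.1) + log h(q.1.2) − log h((collide q.2 q.1).1) − log h((collide q.2 q.1).2)` (surprisal jump,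
`q.1` = PRE pair, `collide q.2 q.1` = POST pair), `J q = (collide q.2 q.1, −q.2)` (inverse collision, an involution:
`inverseCollision_inverseCollision`), `B q = hardSphereKernel (q.1.2, q.1.1) q.2 = ((w − v)·ω)₊`,
`π(ν) = B · ((ν ⊗ ν) ⊗ σ)`, `σ = sphereMeasure`. -/

/-- **Exact parity rigidity** (the `η = 0` case of `ParityStability`; OWN waypoint of v3).  A probability law `ν` on `ℝ³`
with finite second moment and a finite record `κ` on `Q` with finite second moments such that (o) at EVERY bandwidth
`ϑ ∈ (0,1)` every bounded continuous `J`-odd test integrates to zero against the Metropolis-reweighted record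
`min(1,e^{−F^ν_ϑ})·κ`, (f) the ideal contact law `π(ν) = B·((ν⊗ν)⊗σ)` is absolutely continuous w.r.t. `κ`, and (b) the
record is collisionally balanced as a MEASURE identity (gain marginals = loss marginals on `ℝ³`), has EXACTLY isotropic
central second moments.  Proof = the landed chain: (o) ⇒ `J`-invariance of the reweighted record (p139072
`stub_mapInverseCollisionOfOddIntegrals`); (b) + `|log h_ϑ(v)| ≤ C_ϑ(1+|v|²)` + energy conservation of `collide` ⇒
`F_ϑ` is `κ`-integrable with `∫F_ϑ dκ = 0` (`integral_map` four times); `F_ϑ ∘ J = −F_ϑ` (`collide_neg_dir`,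
`collide_collide`); p138663 `stub_detailedBalanceOfSymmetricRecord` with (f) ⇒ `F_ϑ = 0` `π(ν)`-a.e.; p139366
`stub_productionZeroOfDetailedBalance` ⇒ the even production vanishes at every `ϑ ∈ (0,1)`; p137939
`stub_isotropyOfVanishingProduction` (`ϑ₀ = 1`) ⇒ isotropy.  Analytic facts on `h_ϑ`: `ParityRigidityMollify`
(`integral_localMaxwellian_pos`, `measurable_integral_localMaxwellian`, `integral_localMaxwellian_eq`, `surprisal_eq`). -/
def ExactParityRigidity : Prop :=
  ∀ (ν : Measure V3) [IsProbabilityMeasure ν] (κ : Measure ((V3 × V3) × Metric.sphere (0 : V3) 1))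
    [IsFiniteMeasure κ],
    Integrable (fun v : V3 => ‖v‖ ^ 2) ν →
    Integrable (fun q : (V3 × V3) × Metric.sphere (0 : V3) 1 => ‖q.1.1‖ ^ 2 + ‖q.1.2‖ ^ 2) κ →
    let h : ℝ → V3 → ℝ := fun ϑ v => ∫ v', localMaxwellian 1 (ϑ ^ 2) v v' ∂ν
    let F : ℝ → (V3 × V3) × Metric.sphere (0 : V3) 1 → ℝ := fun ϑ q =>
      Real.log (h ϑ q.1.1) + Real.log (h ϑ q.1.2) -
        Real.log (h ϑ (collide q.2 q.1).1) - Real.log (h ϑ (collide q.2 q.1).2)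
    (∀ ϑ : ℝ, 0 < ϑ → ϑ < 1 → ∀ Ψ : (V3 × V3) × Metric.sphere (0 : V3) 1 → ℝ, Continuous Ψ →
      (∃ C : ℝ, ∀ q, |Ψ q| ≤ C) → (∀ q, Ψ (collide q.2 q.1, -q.2) = -Ψ q) →
      ∫ q, Ψ q * min 1 (Real.exp (-(F ϑ q))) ∂κ = 0) →
    (((ν.prod ν).prod sphereMeasure).withDensity
        (fun q => ENNReal.ofReal (hardSphereKernel (q.1.2, q.1.1) q.2))) ≪ κ →
    κ.map (fun q => (collide q.2 q.1).1) + κ.map (fun q => (collide q.2 q.1).2) =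
      κ.map (fun q => q.1.1) + κ.map (fun q => q.1.2) →
    ∃ θ : ℝ, 0 ≤ θ ∧ ∃ u : V3, (∀ j : Fin 3, ∫ v, v j ∂ν = u j) ∧
      ∀ j k : Fin 3, ∫ v, (v j - u j) * (v k - u k) ∂ν = (if j = k then θ else 0)

/-- **Joint weak continuity of the Metropolis-odd test functional at fixed bandwidth** (OWN waypoint of v3).  Along
`ν_n → ν` weakly (probability laws on `ℝ³` with second moments `≤ M`) and `κ_n → κ` weakly (finite records on `Q` with
second moments `≤ M`), for every `ϑ ∈ (0,1)` and every bounded continuous `Ψ`: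
`∫ Ψ min(1, e^{−F^{ν_n}_ϑ}) dκ_n → ∫ Ψ min(1, e^{−F^ν_ϑ}) dκ`.  Proof: `h^{ν_n}_ϑ → h^ν_ϑ` pointwise (bounded continuous
Gaussian integrand) and `{h^{ν_n}_ϑ}` is equi-Lipschitz (`‖∇G_ϑ‖_∞ < ∞`), hence locally uniform convergence; tightness of
`(ν_n)` (Markov on the second moments) gives `h^{ν_n}_ϑ ≥ c(K) > 0` on compacts uniformly in `n`, so `F^{ν_n}_ϑ → F^ν_ϑ`
uniformly on compacts of `Q` (`collide` continuous); `x ↦ min(1,e^{−x})` is 1-Lipschitz and the integrand is bounded by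
`sup|Ψ|`; tightness of `(κ_n)` (Markov) + `κ_n → κ` on the bounded continuous limit integrand finish. -/
def SurprisalTestContinuity : Prop :=
  ∀ (M : ℝ) (νs : ℕ → ProbabilityMeasure V3) (ν : ProbabilityMeasure V3)
    (κs : ℕ → FiniteMeasure ((V3 × V3) × Metric.sphere (0 : V3) 1))
    (κ : FiniteMeasure ((V3 × V3) × Metric.sphere (0 : V3) 1)),
    Tendsto νs atTop (𝓝 ν) → Tendsto κs atTop (𝓝 κ) →
    (∀ n, Integrable (fun v : V3 => ‖v‖ ^ 2) (νs n : Measure V3) ∧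
      ∫ v, ‖v‖ ^ 2 ∂(νs n : Measure V3) ≤ M) →
    (∀ n, Integrable (fun q : (V3 × V3) × Metric.sphere (0 : V3) 1 => ‖q.1.1‖ ^ 2 + ‖q.1.2‖ ^ 2)
        (κs n : Measure ((V3 × V3) × Metric.sphere (0 : V3) 1)) ∧
      ∫ q, (‖q.1.1‖ ^ 2 + ‖q.1.2‖ ^ 2) ∂(κs n : Measure ((V3 × V3) × Metric.sphere (0 : V3) 1)) ≤ M) →
    ∀ ϑ : ℝ, 0 < ϑ → ϑ < 1 → ∀ Ψ : (V3 × V3) × Metric.sphere (0 : V3) 1 → ℝ, Continuous Ψ →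
      (∃ C : ℝ, ∀ q, |Ψ q| ≤ C) →
      let h : Measure V3 → V3 → ℝ := fun μ v => ∫ v', localMaxwellian 1 (ϑ ^ 2) v v' ∂μ
      let F : Measure V3 → (V3 × V3) × Metric.sphere (0 : V3) 1 → ℝ := fun μ q =>
        Real.log (h μ q.1.1) + Real.log (h μ q.1.2) -
          Real.log (h μ (collide q.2 q.1).1) - Real.log (h μ (collide q.2 q.1).2)
      Tendsto (fun n => ∫ q, Ψ q * min 1 (Real.exp (-(F (νs n : Measure V3) q)))
          ∂(κs n : Measure ((V3 × V3) × Metric.sphere (0 : V3) 1))) atTop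
        (𝓝 (∫ q, Ψ q * min 1 (Real.exp (-(F (ν : Measure V3) q)))
          ∂(κ : Measure ((V3 × V3) × Metric.sphere (0 : V3) 1))))

/-- **Moments and the floor along weakly convergent sequences** (OWN waypoint of v3; standard truncation / uniform
integrability facts, packaged).  ν-part: along `ν_n → ν` weakly with `∫|v|³dν_n ≤ M` (integrable): the limit has
`∫|v|³dν ≤ M` (lower semicontinuity: `|v|³ ∧ k` is bounded continuous, monotone convergence in `k`), first and second
coordinate moments CONVERGE (uniform integrability from the cubic bound: truncate at `|v| ≤ R`, tails `≤ M/R`), and for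
nonneg bounded continuous `Ξ` the floor integral `∫ Ξ B d((ν⊗ν)⊗σ)` is lower semicontinuous along the sequence
(`ν_n ⊗ ν_n → ν ⊗ ν` weakly: `ProbabilityMeasure`/`FiniteMeasure.continuous_prod`; then `⊗ σ`, `σ` finite; `Ξ B ∧ k`
bounded continuous; `B ≤ |v| + |w|` integrable).  κ-part: along `κ_n → κ` weakly (finite measures on `Q`) with second
moments `≤ M` and mass `≤ M`, the limit has the same bounds (lsc / continuity of the mass). -/
def MomentSemicontinuity : Prop :=
  (∀ (M : ℝ) (νs : ℕ → ProbabilityMeasure V3) (ν : ProbabilityMeasure V3), Tendsto νs atTop (𝓝 ν) →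
    (∀ n, Integrable (fun v : V3 => ‖v‖ ^ 3) (νs n : Measure V3) ∧
      ∫ v, ‖v‖ ^ 3 ∂(νs n : Measure V3) ≤ M) →
    (Integrable (fun v : V3 => ‖v‖ ^ 3) (ν : Measure V3) ∧ ∫ v, ‖v‖ ^ 3 ∂(ν : Measure V3) ≤ M) ∧
    (∀ j : Fin 3, Tendsto (fun n => ∫ v, v j ∂(νs n : Measure V3)) atTop (𝓝 (∫ v, v j ∂(ν : Measure V3)))) ∧
    (∀ j k : Fin 3, Tendsto (fun n => ∫ v, v j * v k ∂(νs n : Measure V3)) atTop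
      (𝓝 (∫ v, v j * v k ∂(ν : Measure V3)))) ∧
    (∀ Ξ : (V3 × V3) × Metric.sphere (0 : V3) 1 → ℝ, Continuous Ξ → (∀ q, 0 ≤ Ξ q) →
      (∃ C : ℝ, ∀ q, Ξ q ≤ C) → ∀ (b : ℕ → ℝ) (c : ℝ), Tendsto b atTop (𝓝 c) →
      (∀ n, ∫ q, Ξ q * hardSphereKernel (q.1.2, q.1.1) q.2
          ∂(((νs n : Measure V3).prod (νs n : Measure V3)).prod sphereMeasure) ≤ b n) →
      ∫ q, Ξ q * hardSphereKernel (q.1.2, q.1.1) q.2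
          ∂(((ν : Measure V3).prod (ν : Measure V3)).prod sphereMeasure) ≤ c)) ∧
  (∀ (M : ℝ) (κs : ℕ → FiniteMeasure ((V3 × V3) × Metric.sphere (0 : V3) 1))
    (κ : FiniteMeasure ((V3 × V3) × Metric.sphere (0 : V3) 1)), Tendsto κs atTop (𝓝 κ) →
    (∀ n, Integrable (fun q : (V3 × V3) × Metric.sphere (0 : V3) 1 => ‖q.1.1‖ ^ 2 + ‖q.1.2‖ ^ 2)
        (κs n : Measure ((V3 × V3) × Metric.sphere (0 : V3) 1)) ∧
      ∫ q, (‖q.1.1‖ ^ 2 + ‖q.1.2‖ ^ 2) ∂(κs n : Measure ((V3 × V3) × Metric.sphere (0 : V3) 1)) ≤ M ∧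
      ((κs n : Measure ((V3 × V3) × Metric.sphere (0 : V3) 1)) Set.univ).toReal ≤ M) →
    Integrable (fun q : (V3 × V3) × Metric.sphere (0 : V3) 1 => ‖q.1.1‖ ^ 2 + ‖q.1.2‖ ^ 2)
        (κ : Measure ((V3 × V3) × Metric.sphere (0 : V3) 1)) ∧
      ∫ q, (‖q.1.1‖ ^ 2 + ‖q.1.2‖ ^ 2) ∂(κ : Measure ((V3 × V3) × Metric.sphere (0 : V3) 1)) ≤ M ∧
      ((κ : Measure ((V3 × V3) × Metric.sphere (0 : V3) 1)) Set.univ).toReal ≤ M)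

/-- **Countable determining test families** (OWN waypoint of v3).  There are countably many bounded continuous `Φ_i` on
`Q`, nonneg bounded continuous `Ξ_i` on `Q`, bounded continuous `c_i` on `ℝ³` and bandwidths `ϑ_k ∈ (0,1)` such that,
for every probability law `ν` with finite second moment, every finite record `κ` and every `c₀ > 0`, the EXACT countable
identities — (o) `∫ (Φ_i − Φ_i ∘ J) min(1,e^{−F^ν_{ϑ_k}}) dκ = 0` for all `i,k`; (f) `c₀ ∫ Ξ_i B d((ν⊗ν)⊗σ) ≤ ∫ Ξ_i dκ`
for all `i`; (b) `∫ Δc_i dκ = 0` for all `i` — imply the three hypotheses of `ExactParityRigidity`.  Proof: (o) `Φ_i` :=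
the monomials in a countable point-separating family of bounded continuous functions on the Polish space `Q` — a
countable set whose linear span is a separating subalgebra, so `ext_of_forall_mem_subalgebra_integral_eq_of_polish`
gives `J`-invariance of `min(1,e^{−F_{ϑ_k}})·κ` (finite) at each `ϑ_k` (alternatively `Measure.ext_of_charFun` through
the embedding `Q ⊂ ℝ⁹`), hence vanishing of all `J`-odd integrals at `ϑ_k` (`integral_map`); `{ϑ_k}` dense in `(0,1)`
(e.g. the rationals) and `ϑ ↦ ∫ Ψ min(1,e^{−F^ν_ϑ}) dκ` continuous on `(0,1)` (dominated convergence: `h_ϑ(v)` is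
continuous in `ϑ > 0` and positive) give all `ϑ`.  (f) `Ξ_i` := `1 − (IsClosed.apprSeq Vᶜ m)` for `V` in a countable
family of open sets closed under finite unions and containing a countable base: monotone convergence gives
`c₀ π(V) ≤ κ(V)` on that family, then on all open sets (increasing unions), then `π ≪ κ` by outer regularity of the finite
measure `κ` on the metric space `Q`.  (b) `c_i` := a countable determining family on `ℝ³` as in (o): the four
push-forwards are finite measures with `∫ c_i d(gain) = ∫ c_i d(loss)` for all `i`. -/
def CountableTestUpgrade : Prop :=
  ∃ (Φ₀ : ℕ → (V3 × V3) × Metric.sphere (0 : V3) 1 → ℝ)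
    (Ξ₀ : ℕ → (V3 × V3) × Metric.sphere (0 : V3) 1 → ℝ) (C₀ : ℕ → V3 → ℝ) (ϑ₀ : ℕ → ℝ),
    (∀ i, Continuous (Φ₀ i) ∧ ∃ C : ℝ, ∀ q, |Φ₀ i q| ≤ C) ∧
    (∀ i, Continuous (Ξ₀ i) ∧ (∀ q, 0 ≤ Ξ₀ i q) ∧ ∃ C : ℝ, ∀ q, Ξ₀ i q ≤ C) ∧
    (∀ i, Continuous (C₀ i) ∧ ∃ C : ℝ, ∀ v, |C₀ i v| ≤ C) ∧
    (∀ k, 0 < ϑ₀ k ∧ ϑ₀ k < 1) ∧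
    ∀ (ν : Measure V3) [IsProbabilityMeasure ν] (κ : Measure ((V3 × V3) × Metric.sphere (0 : V3) 1))
      [IsFiniteMeasure κ] (c₀ : ℝ), 0 < c₀ →
      Integrable (fun v : V3 => ‖v‖ ^ 2) ν →
      let h : ℝ → V3 → ℝ := fun ϑ v => ∫ v', localMaxwellian 1 (ϑ ^ 2) v v' ∂ν
      let F : ℝ → (V3 × V3) × Metric.sphere (0 : V3) 1 → ℝ := fun ϑ q =>
        Real.log (h ϑ q.1.1) + Real.log (h ϑ q.1.2) -
          Real.log (h ϑ (collide q.2 q.1).1) - Real.log (h ϑ (collide q.2 q.1).2)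
      (∀ i k, ∫ q, (Φ₀ i q - Φ₀ i (collide q.2 q.1, -q.2)) * min 1 (Real.exp (-(F (ϑ₀ k) q))) ∂κ = 0) →
      (∀ i, c₀ * ∫ q, Ξ₀ i q * hardSphereKernel (q.1.2, q.1.1) q.2 ∂((ν.prod ν).prod sphereMeasure) ≤
        ∫ q, Ξ₀ i q ∂κ) →
      (∀ i, ∫ q, (C₀ i (collide q.2 q.1).1 + C₀ i (collide q.2 q.1).2 - C₀ i q.1.1 - C₀ i q.1.2) ∂κ = 0) →
      (∀ ϑ : ℝ, 0 < ϑ → ϑ < 1 → ∀ Ψ : (V3 × V3) × Metric.sphere (0 : V3) 1 → ℝ, Continuous Ψ →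
        (∃ C : ℝ, ∀ q, |Ψ q| ≤ C) → (∀ q, Ψ (collide q.2 q.1, -q.2) = -Ψ q) →
        ∫ q, Ψ q * min 1 (Real.exp (-(F ϑ q))) ∂κ = 0) ∧
      (((ν.prod ν).prod sphereMeasure).withDensity
          (fun q => ENNReal.ofReal (hardSphereKernel (q.1.2, q.1.1) q.2)) ≪ κ) ∧
      (κ.map (fun q => (collide q.2 q.1).1) + κ.map (fun q => (collide q.2 q.1).2) =
        κ.map (fun q => q.1.1) + κ.map (fun q => q.1.2))

/-! ### §1d The kinetic half's mid-level waypoint (v4): isotropy of the WINDOW covariances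

`stub_kineticHalf` is split (v4, lead c2) at its one natural seam into `stub_windowCovarianceIsotropy` (per-window
application of `ParityStability` to the finite-`N` window law / window record + Chebyshev + energy pricing of bad windows)
and `stub_stressIsotropyOfWindowCovariance` (the exact window-to-cone identity `a:∫bt P_r ds = a:C_w − a:D_w` with the
momentum-freezing bound on `D_w` over the `r²`-wide time windows, file header (A)).  The waypoint between them: -/

/-- **Isotropy of the window covariances, in band, pre-shock** (OWN waypoint of v4).  Frame VERBATIM the PW inputs'
(Euler-tied local-Gibbs data, horizon `0 < τ < T`, nonneg continuous density cut-off `g` vanishing above `η₀`); windows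
at `(t₀, x₀) ∈ [0,τ] × 𝕋³` = tent in time of width `r²` × cone in space of width `r` (the SAME `bt`, `bx` as
`OddContactSymmetryPW` / `RateFloorPW` v3); window mass `ρ_w = ∫bt ρ_r`, window momentum `m_w = ∫bt m_r`, window second
moments `E_w = ∫bt ∫b_x v⊗v dμ_s`, and `C_w := E_w − m_w⊗m_w/ρ_w` (= `ρ_w ×` the central covariance of the normalised window
law; Lean `x/0 = 0` on empty windows, where `E_w = 0` too).  CLAIM: the `g(σ³ρ_w)`-weighted `L¹(dt₀dx₀)`-norm of the
DEVIATOR of `C_w` (entrywise `ℓ¹` distance to `(tr C_w/3)𝟙`) is small in probability, `N → ∞` then `r → 0`.  This is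
exactly what `ParityStability` delivers window by window (good windows: deviator `≤ ρ_w(9ε + 9ε²)`; bad / dilute / hot /
high-moment windows: deviator `≤ 2 tr C_w ≤ 4∫bt e_r`, priced by their energy) and exactly what the window-to-cone
identity consumes (`a` traceless ⇒ `a:C_w = a:dev C_w`). -/
def WindowCovarianceIsotropy : Prop :=
  ∃ η₀ : ℝ, 0 < η₀ ∧ ∀ (a₀ θ₀ : T3 → ℝ) (u₀ : T3 → V3), Continuous a₀ → Continuous θ₀ → Continuous u₀ →
    (∀ x, 0 < a₀ x) → (∀ x, 0 < θ₀ x) → ∃ σ₀ : ℝ, 0 < σ₀ ∧ ∀ σ : ℝ, 0 < σ → σ < σ₀ →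
    ∀ (T : ℝ) (ρ θ : ℝ → T3 → ℝ) (u : ℝ → T3 → V3), IsHardSphereEulerSolution σ T ρ u θ →
    ∀ Φ : (N : ℕ) → HardSphereFlow (Torus.geometry (Fin 3)) (hsDiameter σ N) (N + 1),
    TendstoHydroFieldsAt (fun N => localGibbsLaw σ a₀ u₀ θ₀ N (Φ N)) Φ ρ u θ 0 →
    ∀ τ : ℝ, 0 < τ → τ < T → ∀ g : ℝ → ℝ, Continuous g → (∀ b, η₀ ≤ b → g b = 0) → (∀ b, 0 ≤ g b) →
    ∀ η δ : ℝ, 0 < η → 0 < δ → ∃ r₀ : ℝ, 0 < r₀ ∧ ∀ r : ℝ, 0 < r → r < r₀ → ∃ N₀ : ℕ, ∀ N : ℕ, N₀ ≤ N →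
    let γ : Config (N + 1) (Fin 3) T3 → ℝ → Config (N + 1) (Fin 3) T3 := fun z s => (Φ N).flow s z
    let bx : T3 → T3 → ℝ := fun y x₀ => 3 / (Real.pi * r ^ 3) * max (1 - Torus.euclidDist y x₀ / r) 0
    let bt : ℝ → ℝ := fun a => (r ^ 2)⁻¹ * max (1 - |a| / r ^ 2) 0
    let ρw : Config (N + 1) (Fin 3) T3 → ℝ → T3 → ℝ := fun z t₀ x₀ =>
      ∫ s in Set.Icc (0 : ℝ) τ, bt (s - t₀) * ∫ q, bx q.1 x₀ ∂(empiricalMeasure (γ z s))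
    let mw : Config (N + 1) (Fin 3) T3 → ℝ → T3 → Fin 3 → ℝ := fun z t₀ x₀ j =>
      ∫ s in Set.Icc (0 : ℝ) τ, bt (s - t₀) * ∫ q, bx q.1 x₀ * q.2 j ∂(empiricalMeasure (γ z s))
    let Ew : Config (N + 1) (Fin 3) T3 → ℝ → T3 → Fin 3 → Fin 3 → ℝ := fun z t₀ x₀ j k =>
      ∫ s in Set.Icc (0 : ℝ) τ, bt (s - t₀) * ∫ q, bx q.1 x₀ * (q.2 j * q.2 k) ∂(empiricalMeasure (γ z s))
    let Cw : Config (N + 1) (Fin 3) T3 → ℝ → T3 → Fin 3 → Fin 3 → ℝ := fun z t₀ x₀ j k =>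
      Ew z t₀ x₀ j k - mw z t₀ x₀ j * mw z t₀ x₀ k / ρw z t₀ x₀
    let dev : Config (N + 1) (Fin 3) T3 → ℝ → T3 → ℝ := fun z t₀ x₀ =>
      ∑ j : Fin 3, ∑ k : Fin 3, |Cw z t₀ x₀ j k - if j = k then (∑ l : Fin 3, Cw z t₀ x₀ l l) / 3 else 0|
    let D : Config (N + 1) (Fin 3) T3 → ℝ := fun z =>
      ∫ t₀ in Set.Icc (0 : ℝ) τ, ∫ x₀ : T3, g (σ ^ 3 * ρw z t₀ x₀) * dev z t₀ x₀
    localGibbsLaw σ a₀ u₀ θ₀ N (Φ N) {z | η < D z} ≤ ENNReal.ofReal δ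

/-! ## §2 The stubs -/

/-- STUB (external inputs, ONE registered stub as in the sister's v11 `stub_inputs`): the four BOARD ITEMS the landed pipeline
consumes verbatim — `TwoClocks.EnergyCurrentTails` (stmt-9235; readout, UI steps, cubic moments of window laws),
`LimitCollisionMeasure.CollisionTightness` (stmt-13354; ⇒ `CollisionMomentUI` by p110597; mass / second moments of window
records), `InformationPercolationEngine.CollisionRate` (stmt-13481; readout + reduction only), the clamped
`LimitCollisionMeasure.LocalSecondLaw` (stmt-13352; the plain 13081 is idle, Disproof §5) — and the two RESTATED kinetic
inputs `OddContactSymmetryPW`, `RateFloorPW` (§1b).  Stub-blocked on those items / on the restatement; not this line's to prove. -/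
theorem stub_inputs :
    TwoClocks.EnergyCurrentTails ∧ LimitCollisionMeasure.CollisionTightness ∧
    InformationPercolationEngine.CollisionRate ∧ LimitCollisionMeasure.LocalSecondLaw ∧
    OddContactSymmetryPW ∧ RateFloorPW := by
  sorry

/-- CLOSED (landed p164294, `Theorems.ParityBandClosureExactRigidity.stub_exactParityRigidity`): exact parity rigidity —
composition of the landed chain (docstring of `ExactParityRigidity`). -/
theorem stub_exactParityRigidity : ExactParityRigidity :=
  Summit.AtomisticToContinuum.HydrodynamicLimit.Theorems.ParityBandClosureExactRigidity.stub_exactParityRigidity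

/-- CLOSED (landed p165357 + helper p165132, `Theorems.ParityBandClosureSurprisalContinuity.stub_surprisalTestContinuity`):
joint weak continuity of the Metropolis-odd functional (docstring of `SurprisalTestContinuity`). -/
theorem stub_surprisalTestContinuity : SurprisalTestContinuity :=
  Summit.AtomisticToContinuum.HydrodynamicLimit.Theorems.ParityBandClosureSurprisalContinuity.stub_surprisalTestContinuity

/-- CLOSED (landed p164742, `Theorems.ParityBandClosureMomentSemicontinuity.stub_momentSemicontinuity`): moments and the
floor along weakly convergent sequences (docstring of `MomentSemicontinuity`). -/
theorem stub_momentSemicontinuity : MomentSemicontinuity :=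
  Summit.AtomisticToContinuum.HydrodynamicLimit.Theorems.ParityBandClosureMomentSemicontinuity.stub_momentSemicontinuity

/-- CLOSED (landed p165416 + helper p165090, `Theorems.ParityBandClosureCountableUpgrade.stub_countableTestUpgrade`):
countable determining test families (docstring of `CountableTestUpgrade`). -/
theorem stub_countableTestUpgrade : CountableTestUpgrade :=
  Summit.AtomisticToContinuum.HydrodynamicLimit.Theorems.ParityBandClosureCountableUpgrade.stub_countableTestUpgrade

/-- CLOSED (landed p165739 + helper p165240, `Theorems.ParityBandClosureStabilityAssembly.stub_parityStabilityOfRigidity`): the compactness assembly — `ParityStability` from the four waypoints.  By contradiction: fix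
`(M, cmin, ε)`; take the countable families of `CountableTestUpgrade` and at stage `n` the first `n` tests
(`Ψ_j := Φ_i − Φ_i ∘ J` at bandwidth `ϑ_k`, `(i,k) := Nat.unpair j`; `Ξ_j := Ξ₀ j`; `c_j := C₀ j`) with `η := 1/(n+1)`;
a failing pair `(ν_n, κ_n, c₀ⁿ)` exists for every `n`.  WLOG `c₀ⁿ = cmin` on the floor side (the floor integral is
`≥ 0`).  Extraction: `(ν_n)` lies in the compact set `{μ | ∀ m, μ (closedBall 0 (m+1))ᶜ ≤ M/(m+1)³}` of the metrizable
space `ProbabilityMeasure ℝ³` (Markov; `isCompact_setOf_probabilityMeasure_mass_eq_compl_isCompact_le`,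
`instMetrizableSpaceProbabilityMeasure`, `IsCompact.tendsto_subseq`); masses `κ_n(Q) ∈ [0, M]` have a convergent
subsequence (`tendsto_subseq_of_bounded`), limit `0` ⇒ `κ_n → 0` weakly, limit `m > 0` ⇒ the normalised records
(`FiniteMeasure.normalize`, `self_eq_mass_smul_normalize`) are eventually tight (second moments `≤ 2M/m`) and a further
subsequence converges, so `κ_n = mass • normalize → κ` in `FiniteMeasure Q`.  Limit identities: (o) by
`SurprisalTestContinuity` (each `(i,k)` is tested from some stage on, tolerance `→ 0`); (f) by the floor clause of
`MomentSemicontinuity` with `b n := (∫Ξ₀ i dκ_n + 1/(n+1))/cmin`; (b) and `∫Ξ₀ i dκ_n → ∫Ξ₀ i dκ` by weak convergence on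
bounded continuous integrands; limit moment bounds by `MomentSemicontinuity`.  Then `CountableTestUpgrade` (with
`c₀ := cmin`) and `ExactParityRigidity` give exact isotropy `(θ, u)` of the limit `ν`; by the moment convergence of
`MomentSemicontinuity` the pairs `ν_n` are `ε`-isotropic with the same `(θ, u)` for `n` large — contradiction. -/
theorem stub_parityStabilityOfRigidity :
    ExactParityRigidity → SurprisalTestContinuity → MomentSemicontinuity → CountableTestUpgrade →
    ParityStability :=
  Summit.AtomisticToContinuum.HydrodynamicLimit.Theorems.ParityBandClosureStabilityAssembly.stub_parityStabilityOfRigidity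

/-- CLOSED (v3 (B), all five pieces landed; standalone tree copy p166406
`Theorems.ParityBandClosureParityStability.stub_parityStability`): **parity stability**. -/
theorem parityStability_closed : ParityStability :=
  stub_parityStabilityOfRigidity stub_exactParityRigidity stub_surprisalTestContinuity stub_momentSemicontinuity
    stub_countableTestUpgrade

/-- STUB (OWN, XL−, v4 split of the kinetic half, FIRST piece): `ParityStability` + the two PW inputs + `DensityCap` +
9235 + 13354 ⇒ `WindowCovarianceIsotropy`.  FINITE `N`, window by window, no limit objects.  Per window `(t₀,x₀)`
(weights `bt(s−t₀)bx(xᵢ(s),x₀)`): `ν_w :=` the normalised space–time window law on `ℝ³` (mass `ρ_w` divided out),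
`κ_w :=` the `bt·bx`-weighted `ε/(N+1)`-normalised collision record pushed to `(ℝ³×ℝ³)×S²` by `(s,i,j) ↦ ((vᵢ⁻,vⱼ⁻), n̂ᵢⱼ)`
(`pv` = PRE pair via `reflectVel` = `collide`, `n̂ = ε⁻¹sepVec ∈ S²`; `reflectVel_eq_collide`), `c₀ := g₀σ³ρ_w²`.
DICTIONARY (deterministic, one good orbit): (o) the `OddContactSymmetryPW` window functional `K_w[Ψ,ϑ]` equals
`∫ Ψ̃ min(1,e^{−F^{ν_w}_ϑ}) dκ_w` EXACTLY (`F` is a log-RATIO: `hw = ρ_w · h^{ν_w}_ϑ`, the four `log ρ_w` cancel; `Ψ̃` = any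
bounded continuous `J`-odd extension of the test from `S²` to `ℝ³` in the direction slot, e.g. `φ(‖n‖)Ψ((v,w), n/‖n‖)`);
(f) `B_w[Ξ] = ρ_w² ∫ Ξ̃ B d((ν_w⊗ν_w)⊗σ)` and `K_w[Ξ] = ∫ Ξ̃ dκ_w` EXACTLY (two-time products AFTER windowing = product of the
window law with itself; `Θ(v,w) = ∫ Ξ(ω,v,w) B((w,v),ω) dσ`); (b) `|∫ Δc dκ_w| ≤ ε · C(c, r, τ) · (1 + Ē + ε(N+1)⁻¹#coll)` from
`empiricalEnskogIdentity_proof` (13086, PROVED) with the time test `a := bt(· − t₀)` and space test `b := bx(·, x₀)` replaced by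
`C¹`/smooth approximants (`bt`, `bx` are Lipschitz, not smooth: mollify, `‖·‖_∞`-error × `K_w[|Δc|]`), `c` bounded continuous;
moments: `∫|v|³dν_w = (∫bt∫bx|v|³)/ρ_w`, record mass / second moments = `K_w[1]`, `K_w[|v⁻|²+|w⁻|²]`.  ASSEMBLY: given
`(g, η, δ)`, fix `V` (tail, 9235: `∫₀^τ E[tail₃] ≤ τε'`, Markov), `Λ` (hot windows), `cmin` (dilute windows: `ρ_w² < cmin/(g₀σ³)`
carry energy `≤ ½V²√(cmin/g₀σ³)·|𝕋³|τ + tails`), `ε`; take `ParityStability`'s finite test data for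
`(M := moment budget from 9235/13354/DensityCap by Markov, cmin·g₀σ³-normalised, ε)`; instantiate `OddContactSymmetryPW` at each
`(Ψ̃_j, ϑ_j)`, `RateFloorPW` at each `Ξ̃_j` (finitely many instances ⇒ one `r₀`, one `N₀` by `min`/`max`), EEI at each `c_j`;
Chebyshev: the windows failing some test by `> η_PS` have `g`-weighted measure `≤ (Σ_j D_j)/η_PS`, small w.h.p.; good
non-dilute warm bounded-moment windows: `ParityStability` ⇒ `dev C_w ≤ ρ_w(9ε+9ε²)`; all other windows: `dev C_w ≤ 2 tr C_w ≤
4∫bt e_r ds`, and a window set `S` of small measure carries energy `∫_S∫bt e_r ≤ ½V²(ρ_max + η_DC)|S| + τ·Tail_V` (`DensityCap` is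
POINTWISE: `ρ_r(s,x) ≤ ρ(s,x) + η` for all `s ≤ t`, all `x`, w.h.p.).  `η₀ :=` `OddContactSymmetryPW`'s. -/
theorem stub_windowCovarianceIsotropy :
    ParityStability → OddContactSymmetryPW → RateFloorPW → JParityClosure.DensityCap →
    TwoClocks.EnergyCurrentTails → LimitCollisionMeasure.CollisionTightness → WindowCovarianceIsotropy := by
  sorry

/-- STUB (OWN, L–XL−, v4 split of the kinetic half, SECOND piece): `WindowCovarianceIsotropy` + `DensityCap` + 9235 +
13354 ⇒ `WeakStressIsotropyInBand` — the WINDOW-TO-CONE step.  Given WSI's data `(t < T, a, g, η, δ)`: `τ := (t + T)/2`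
(any `τ ∈ (t, T)`; windows are then untruncated above `t` once `r² < τ − t`), `g = g₊ − g₋` (both continuous, nonneg,
vanishing above `η₀`).  DETERMINISTIC CORE (one orbit): (1) insert `1 = ∫bt(s−t₀)dt₀` for `s ∈ [r², t]` (exact: `bt` has unit
mass and support `[−r², r²]`), end layer `s ∈ [0, r²]` costs `≤ r²·‖a‖‖g‖·2Ē`; (2) freeze the weight:
`|g(σ³ρ_r(s,x₀))a(s,x₀) − g(σ³ρ_w(t₀,x₀))a(t₀,x₀)| ≤ ‖g‖ω_a(r²) + ‖a‖ω_g(σ³·osc_w ρ_r)` with `osc_w ρ_r ≤ r²·sup|∂_sρ_r| ≤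
r²·(3/πr⁴)·(mass flux in B_r) = O(r)·(local momentum)`, against `|P_r| ≤ 2e_r`; (3) the EXACT identity for each window:
`∫bt(s−t₀) P_r(s,x₀) ds = C_w(t₀,x₀) − D_w(t₀,x₀)`, `D_w := ∫bt (m_r⊗m_r/ρ_r) ds − m_w⊗m_w/ρ_w ⪰ 0`,
`tr D_w = ∫bt ρ_r|u_r − ũ_w|² ≤ ρ_w⁻¹·(osc_w m_r)²`-type bound, and `a:C_w = a:dev C_w` (`a` traceless) so
`|a:C_w| ≤ ‖a‖_∞ dev C_w`; (4) momentum freezing over the `r²`-window: `osc_w m_r ≤ r²·sup_s|∂_s m_r(s,x₀)|`,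
`|∂_s m_r| ≤ ‖∇b_x‖_∞·2·(energy in B_r(x₀)) + ‖∇b_x‖_∞·(ε/(N+1))·𝒮_w` (free transport + collisional transfer across the cone
edge; the landed `JParityClosureMomentumModulus.abs_momentumObservable_flow_sub_le` / `KineticClosureBridge` cone-commutator
machinery, `‖∇b_x‖ = 3/(πr⁴)`), hence `tr D_w = O(r²Λ²/ρ_min)` on warm (`e_flat ≤ Λ`), non-dilute (`ρ_w ≥ ρ_min`),
transfer-regular windows.  PRICING: `∫∫ g a:D_w` over dilute / hot / transfer-irregular windows `≤ ‖a‖‖g‖ ×` (energy they carry),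
small by `DensityCap` (pointwise cap) + 9235 (`Tail_V`, Markov in time) + 13354 (total transfer `K[|v|+|w|] ≤ Kb`, Markov over
windows); the main term `∫∫ g(σ³ρ_w)|a:C_w| ≤ ‖a‖·D` with `D` the `WindowCovarianceIsotropy` functional.  Order of choices:
`V → Λ, ρ_min → (η', δ') for WCI → r₀ → N₀`.  `η₀ :=` `WindowCovarianceIsotropy`'s. -/
theorem stub_stressIsotropyOfWindowCovariance :
    WindowCovarianceIsotropy → JParityClosure.DensityCap → TwoClocks.EnergyCurrentTails →
    LimitCollisionMeasure.CollisionTightness → WeakStressIsotropyInBand := by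
  sorry

/-- CLOSED modulo the two v4 pieces: **the kinetic half** `ParityStability → OddContactSymmetryPW → RateFloorPW → DensityCap →
9235 → 13354 → WeakStressIsotropyInBand`. -/
theorem stub_kineticHalf :
    ParityStability → OddContactSymmetryPW → RateFloorPW → JParityClosure.DensityCap →
    TwoClocks.EnergyCurrentTails → LimitCollisionMeasure.CollisionTightness → WeakStressIsotropyInBand :=
  fun hPS hO hR hD hT hC =>
    stub_stressIsotropyOfWindowCovariance (stub_windowCovarianceIsotropy hPS hO hR hD hT hC) hD hT hC

/-! ### Closed pieces (LANDED theorems; no `sorry`) -/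

/-- CLOSED (landed p136561, `Theorems.ParityBandClosurePressureValue.stub_pressureValueOfEvenStress`; exact algebra):
`EvenStressEnskog` + weak stress isotropy ⇒ the collisional pressure value. -/
theorem pressureValue_closed :
    JParityClosure.EvenStressEnskog → WeakStressIsotropyInBand → CollisionalPressureValueInBand :=
  Summit.AtomisticToContinuum.HydrodynamicLimit.Theorems.ParityBandClosurePressureValue.stub_pressureValueOfEvenStress

/-- CLOSED (landed p110597, `Theorems.ChaosClosesEulerCollisionMomentUI.stub_collisionMomentUI`): quartic collision
tightness ⇒ UI of the quadratic collision mark. -/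
theorem collisionMomentUI_closed : LimitCollisionMeasure.CollisionTightness → CollisionMomentUI :=
  Summit.AtomisticToContinuum.HydrodynamicLimit.Theorems.ChaosClosesEulerCollisionMomentUI.stub_collisionMomentUI

/-- CLOSED (the sister line's landed chain: kinetic reduction p138091 fed with the exact `C¹` mass balance p133127, Bogolyubov's
weak equation p108039, the `t = 0` layer p97752 and the deterministic BF18 shell p136414): THE RELATIVE-ENERGY GRÖNWALL. -/
theorem gronwall_closed :
    WeakStressIsotropyInBand → CollisionalPressureValueInBand → CollisionMomentUI →
    InformationPercolationEngine.CollisionRate → LimitCollisionMeasure.LocalSecondLaw →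
    InformationPercolationEngine.DensityCap → MollifiedCloseTimeAveraged :=
  fun hS hP hU hR hL hD =>
    Summit.AtomisticToContinuum.HydrodynamicLimit.Theorems.ChaosClosesEulerKineticReduction.stub_kineticReduction
      Summit.AtomisticToContinuum.HydrodynamicLimit.Theorems.ChaosClosesEulerMassBalanceC1.stub_massBalanceC1
      Summit.AtomisticToContinuum.HydrodynamicLimit.Theorems.ChaosClosesEulerWeakEquation.stub_weakEquation
      Summit.AtomisticToContinuum.HydrodynamicLimit.Theorems.ChaosClosesEulerInitialLayer.stub_initialLayer
      hS hP hU hR hL hD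
      Summit.AtomisticToContinuum.HydrodynamicLimit.Theorems.ChaosClosesEulerBF18Shell.stub_bf18Shell

/-! ## §3 The composition (pure logic, no `sorry`) -/

/-- **The line closes the crux modulo its stubs (v3).**  Consumed antecedents: `hE : EvenStressEnskog` (pressure value),
`hD : DensityCap` (kinetic half; and, as the syntactically identical `InformationPercolationEngine.DensityCap`, Grönwall +
readout).  NOT consumed: `_hO : OddContactSymmetry` (17722), `_hR : RateFloor` (13080) — replaced by their POINTWISE
restatements carried in `stub_inputs` (card §A2–A3: the typed fixed-`χ` forms are interface-blocked for any scale-`r`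
conclusion) — and `_hL : LocalSecondLaw` (13081, plain: the Grönwall takes the clamped 13352).  Readout = the LANDED
`ChaosClosesEulerReadout.stub_readout` (p119530) with the landed exact identity (p107599). -/
theorem ParityBandClosure_of : JParityClosure.ParityBandClosure := fun _hO hE _hR _hL hD =>
  have ⟨hT, hCT, hCR, hLSLc, hOPW, hRPW⟩ := stub_inputs
  have hD' : InformationPercolationEngine.DensityCap := hD
  have hUI : CollisionMomentUI := collisionMomentUI_closed hCT
  have hW : WeakStressIsotropyInBand := stub_kineticHalf parityStability_closed hOPW hRPW hD hT hCT
  have hP : CollisionalPressureValueInBand := pressureValue_closed hE hW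
  have hM : MollifiedCloseTimeAveraged := gronwall_closed hW hP hUI hCR hLSLc hD'
  Summit.AtomisticToContinuum.HydrodynamicLimit.Theorems.ChaosClosesEulerReadout.stub_readout hM
    Summit.AtomisticToContinuum.HydrodynamicLimit.Theorems.ChaosClosesEulerEnskogIdentity.stub_empiricalEnskogIdentity
    hT hUI hCR hD'

end Summit.AtomisticToContinuum.HydrodynamicLimit.Cruxes.ParityBandClosure.TransferWeightedParityChain

end
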